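import Summits.Ventures.QEC.CircuitDistance.PortBB144LeafDefs
import Summits.Ventures.QEC.CircuitDistance.FibreLeavesBB144Z8w3_01
import Summits.Ventures.QEC.CircuitDistance.FibreLeavesBB144Z8w3_08
import Summits.Ventures.QEC.CircuitDistance.PortLeafWFFast
import HarnessLib

/-!
# P3-PORT instance `[[144,12,12]]`: leaf ENTRIES Z-word 3 of weight 8 (budget 1) and their kernel checks (cell `qec`, experiment CDX, seat qec-cdx-type-1)

Per orbit representative (eng-1's word data + kernel UNSAT / null-split facts): the `LeafEntry`, `Leaf.wf` (via the fast check `Leaf.wfFast`) and the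
base-column coverage check `covers₂` by `decide +kernel`, packed into `LeafOKX` / `LeafOKZ` (`PortBB144LeafDefs`).
(A₁,A₂,A₃)=(x³,y,y²) per SI p.10 L83; (B₁,B₂,B₃)=(y³,x,x²) per print's positional convention; authors' software labelling = provenance (acq-14097 pending).  No `native_decide`; nothing here asserts a value of `d_circ` by itself.
-/

namespace Summit.Ventures.QEC.CircuitDistance

open Literature.InformationTheory.QuantumCodes

/-- Leaf entry of `Z`-word 3 of `[[144,12,12]]` (eng-1's `FibreBB144Z8.w003_*`: `N₀ = 9`, `w = 9`). -/
def eZ8_003 : LeafEntry 12 6 :=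
  ⟨wordOf144 FibreBB144Z8.w003_word, ⟨739, FibreBB144Z8.w003_coords, FibreBB144Z8.w003_groups, FibreBB144Z8.w003_nulls, FibreBB144Z8.w003_rows, FibreBB144Z8.w003_us, 9⟩⟩


set_option maxRecDepth 100000 in
set_option maxHeartbeats 4000000000 in
/-- KERNEL: the leaf passes the fast well-formedness check `wfFast` (PortLeafWFFast). -/
theorem eZ8_003_wfF : eZ8_003.leaf.wfFast = true := by decide +kernel

/-- The leaf is well-formed. -/
theorem eZ8_003_wf : eZ8_003.leaf.wf = true := Fibre.Leaf.wf_of_wfFast _ eZ8_003_wfF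

set_option maxRecDepth 100000 in
set_option maxHeartbeats 4000000000 in
/-- KERNEL: the leaf COVERS its word (base-column check `covers₂`). -/
theorem eZ8_003_cov : bb144ZTable.covers₂ bb144SM 9 eZ8_003 = true := by decide +kernel

/-- The entry satisfies the hypotheses of the sector theorem (UNREALISED from eng-1's kernel facts). -/
theorem eZ8_003_ok : LeafOKZ eZ8_003 :=
  zentry144_ok_of eZ8_003_wf eZ8_003_cov (by decide) rfl (by decide) (Fibre.Leaf.not_realised_of_nullSplit _ eZ8_003_wf (by decide) FibreBB144Z8.w003_h0 FibreBB144Z8.w003_hc)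

end Summit.Ventures.QEC.CircuitDistance
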